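import Summits.AtomisticToContinuum.HydrodynamicLimit.Theorems.JParityClosureEvenStressEnskogContinuityCorrectionRung0OfShortFlight
import Summits.AtomisticToContinuum.HydrodynamicLimit.Theorems.JParityClosureEvenStressEnskogShortFlightDeficitRung0
import HarnessLib

/-!
# Crux `JParityClosure.EvenStressEnskog` (stmt-AtomisticToContinuum-13079), line
# `even-rung-mean-variance`: helper stub `stub_continuityCorrectionRung0` ((S2b₁) at rung 0)

At RUNG 0 (constant profiles: the local Gibbs law is the homogeneous canonical Gibbs law `G_N`,
stationary under every hard-sphere flow) the CONTINUITY-CORRECTION residual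
`R_cont = continuityCorrection` of the collision-cylinder pull-back is small in probability:
`G_N{((N+1)κ)⁻¹ R_cont > η} ≤ δ` for `κ < κ₀` and `N ≥ N₀`.  This is the registered implication
`continuityCorrectionRung0_of_shortFlight` ((S2b₂)₀ ⇒ (S2b₁)₀: pathwise
`((N+1)κ)⁻¹ R_cont ≤ ε/(N+1) Σ_coll b_N(vᵢ, vⱼ) + 2C_χC_g ((N+1)κ)⁻¹ R_short` by the free flight of the
pair after its flight start, the Lipschitz mollified density and the mean-displacement bound; then
kinetic-energy tightness, the collision-flux upper bound with dominated convergence in `N`, and the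
short-flight event) applied to the landed neighbouring stub `stub_shortFlightDeficitRung0` ((S2b₂)₀,
the short-flight deficit at the same `κ`).

References: C. Cercignani, R. Illner, M. Pulvirenti, *The Mathematical Theory of Dilute Gases* (1994),
§2.2 and App. 4.A; I. Gallagher, L. Saint-Raymond, B. Texier, *From Newton to Boltzmann* (2013), §4.1.
-/

noncomputable section

namespace Summit.AtomisticToContinuum.HydrodynamicLimit.Theorems.EvenStressEnskog

open Literature.Analysis.FluidPDE Literature.MathematicalPhysics.KineticTheory

/-- **Registered helper stub `stub_continuityCorrectionRung0`** ((S2b₁) at rung 0) of the line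
`even-rung-mean-variance` of crux stmt-AtomisticToContinuum-13079: under the rung-0 (homogeneous) Gibbs
law, for `κ < κ₀` and `N ≥ N₀` the normalised continuity correction `((N+1)κ)⁻¹ R_cont` of the
collision-cylinder pull-back exceeds `η` with probability at most `δ` (the implication
`continuityCorrectionRung0_of_shortFlight` fed with the short-flight stub
`stub_shortFlightDeficitRung0`). [folklore] -/
theorem stub_continuityCorrectionRung0 : ∃ η₀ : ℝ, 0 < η₀ ∧ ∀ (a θ : ℝ) (u : V3), 0 < a → 0 < θ → ∃ σ₀ : ℝ, 0 < σ₀ ∧ ∀ σ : ℝ, 0 < σ → σ < σ₀ → ∀ Φ : (N : ℕ) → HardSphereFlow (Torus.geometry (Fin 3)) (hsDiameter σ N) (N + 1), ∀ τ : ℝ, 0 < τ → ∀ χ : ℝ × UnitAddTorus (Fin 3) → ℝ, Continuous χ → ∀ g : ℝ → ℝ, Continuous g → (∀ a, η₀ ≤ a → g a = 0) → ∀ η δ : ℝ, 0 < η → 0 < δ → ∃ r₀ : ℝ, 0 < r₀ ∧ ∀ r : ℝ, 0 < r → r < r₀ → ∀ L : ℝ, 1 ≤ L → ∃ κ₀ :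 ℝ, 0 < κ₀ ∧ ∀ κ : ℝ, 0 < κ → κ < κ₀ → ∃ N₀ : ℕ, ∀ N : ℕ, N₀ ≤ N → ∀ k l : Fin 3, localGibbsLaw σ (fun _ => a) (fun _ => u) (fun _ => θ) N (Φ N) {z | η < ((N + 1 : ℝ) * κ)⁻¹ * continuityCorrection σ N (Φ N) τ χ g (evenMarkTrunc k l L) r κ z} ≤ ENNReal.ofReal δ :=
  continuityCorrectionRung0_of_shortFlight stub_shortFlightDeficitRung0

end Summit.AtomisticToContinuum.HydrodynamicLimit.Theorems.EvenStressEnskog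

end
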